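/-
Copyright: the b2b-balaban cell (near-miss cell 7), T⁴-continuum fan-out; row NE7b ROUND-2 swarm, seat
t4-ne7b-formalise-leaf-04 (gen 3) — row S6g′(a), file 4 «PIECES, TOUCH-CONNECTED FAMILIES, THE SLIM READING» (journal
CLAIM l.9299, located interface point F-leaf04g3-1 l.9871).  Released under the licence of the surrounding project.
-/
import Summits.QuantumFields.BalabanUV.T4Continuum.Support.HistoryZoneMassRegions

/-!
# Zone mass for PIECES, I: pieces of pieces, touch-connected families, and the slim levelled reading

Summits-side support leaf of the T⁴-continuum cell (rung (B)+1 on a FINITE torus only; NOT infinite volume, NOT the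
mass gap, NOT the Clay statement; NOT a proof of the spine estimate NE7b).  Row NE7b, route «COUNT», row S6g′
«MASS-BASED SIBLING COUNT» (R-OWNER-22-12 (2)), step (a).  WHY (F-leaf04g3-1, journal l.9871 — our bookkeeping, not
print's): the cardinality law (`HistoryZoneMassLawLevels.card_zone_le_levels`) displays LINKED zones for EVERY
sub-structure, and `HistoryZoneMassRegions` discharges that from contact at every BINARY merge node; the COUNT
(`HistoryJoinsCount`, leaf-05 g2) asks its cardinality majorant for every canonically admissible placement, which
gives only FOREST contact among the parts of each join cluster (`HistoryJoinsAdm.LocalTop`), under which inner nodes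
of a same-step merger chain may have disconnected zones.  The law's induction, however, only ever meets PIECES
(`HistoryZoneEvolve.parts sh t₀ G`: the maximal sub-structures formed before a cut, and the later births), and pieces
of pieces are pieces; this file and its sequels (`HistoryZoneMassPiecesLaw`, `HistoryZoneMassCluster`) re-run the law
for pieces only, under cluster (forest) contact.  [folklore] finite combinatorics ∕ geometry on OUR carriers; nothing
is quoted from print, nothing printed is asserted, no `[cite:]` tag, no `Prop`-valued fact minted (`TConn`,
`ZoneStepsD` are predicates WITH PARAMETERS ∕ hypothesis shapes); constants symbolic.

WHAT.  §1 pieces algebra over `HistoryZoneEvolve.parts`: `parts_not_renew` (a piece is a birth or a merger),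
`parts_parts_of_le` (cut `t₁ ≤ t₀`: a `t₁`-piece of a `t₀`-piece of `G` is a `t₁`-piece of `G`), `parts_eq_self_of_lt`
(cut `t₀ < t₁`: a `t₀`-piece is its own only `t₁`-piece), **`parts_trans`** (pieces of pieces are pieces),
`self_mem_parts_born`∕`self_mem_parts_merge` (a birth ∕ merger is its own piece for a later cut), `lunion_append`,
`subset_lunion_of_mem`.  §2 **`TConn touch l`** (a list is touch-connected: any two members are joined by a chain of
members with consecutive `touch`), `TConn.mono`, and **`linked_lunion_of_tconn`**: a touch-connected family of
`ρ`-linked sets whose touching pairs are bridged by cells at distance `≤ ρ` has a `ρ`-linked union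
(`HistoryZoneMass.Linked`).  §3 the SLIM levelled reading **`ZoneStepsD sh n L K lv c G zone`** = leaf-07 g2's
`ZoneReadingD` without the `birth` (diameter) and `overlap` (binary contact) fields — range, union at mergers, the
tolerant levelled step, renewals — `ZoneStepsD.of_readingD`, and the ancestor decomposition over it:
`zone_subset_evolveS`, **`zone_subset_partsS`** (= `HistoryZoneEvolveLevels.zone_subset_partsD` verbatim, which used
only these four fields).  §4 sanity.

HONEST: bookkeeping on OUR reading; NE7b NOT proved; spine 0∕9.  HONEST DEPENDENCY (cell): continuum YM on T⁴ ⇐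
BetaPertH ∧ nine spine estimates (0/9 proved); BetaPertH ⇐ (D1) ∧ (D4) ∧ CAP+tail; G-an2-4 gates asym, D1 and
NE2/3/4.  This file changes none of it.
-/

open Finset
open Literature.MathematicalPhysics.QuantumFieldTheory.Balaban1983to89
open T4PersistenceDictionary T4PartnerMultiplicity
open Summit.QuantumFields.BalabanUV.T4Continuum.PlacementSkeleton
open Summit.QuantumFields.BalabanUV.T4Continuum.Crowding
open Summit.QuantumFields.BalabanUV.T4Continuum.ZoneSkeleton
open Summit.QuantumFields.BalabanUV.T4Continuum.ZoneTorus
open Summit.QuantumFields.BalabanUV.T4Continuum.HistoryZones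
open Summit.QuantumFields.BalabanUV.T4Continuum.HistoryZoneMass
open Summit.QuantumFields.BalabanUV.T4Continuum.HistoryZoneEvolve
open Summit.QuantumFields.BalabanUV.T4Continuum.HistoryZoneEvolveLevels

namespace Summit.QuantumFields.BalabanUV.T4Continuum.HistoryZoneMassPieces

noncomputable section

variable {d : ℕ}

/-! ## §1 Pieces of pieces are pieces -/

section Pieces

variable {ε : Type*} {sh : ε → PEv}

/-- **A PIECE IS A BIRTH OR A MERGER**, never a renewal node (renewals are transparent to `parts`). [folklore] -/
theorem parts_not_renew (t₀ : ℕ) :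
    ∀ {X p : Gen ε}, p ∈ parts sh t₀ X → ∀ (Y : Gen ε) (e : ε) (h : ℕ), p ≠ Gen.renew Y e h
  | Gen.born b j, p, hp, Y, e', h' => by
      simp only [parts, List.mem_singleton] at hp; subst hp; intro h; cases h
  | Gen.renew W e h, p, hp, Y, e', h' => parts_not_renew t₀ (X := W) hp Y e' h'
  | Gen.merge A B e, p, hp, Y, e', h' => by
      simp only [parts] at hp
      split_ifs at hp with hlt
      · simp only [List.mem_singleton] at hp; subst hp; intro h; cases h
      · rcases List.mem_append.1 hp with h | h
        · exact parts_not_renew t₀ h Y e' h'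
        · exact parts_not_renew t₀ h Y e' h'

/-- **REFINEMENT** (`t₁ ≤ t₀`): a `t₁`-piece of a `t₀`-piece of `G` is a `t₁`-piece of `G`. [folklore] -/
theorem parts_parts_of_le {t₀ t₁ : ℕ} (h : t₁ ≤ t₀) :
    ∀ {G X p : Gen ε}, X ∈ parts sh t₀ G → p ∈ parts sh t₁ X → p ∈ parts sh t₁ G
  | Gen.born b j, X, p, hX, hp => by
      simp only [parts, List.mem_singleton] at hX; subst hX; exact hp
  | Gen.renew W e hh, X, p, hX, hp => parts_parts_of_le h (G := W) hX hp
  | Gen.merge A B e, X, p, hX, hp => by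
      simp only [parts] at hX
      split_ifs at hX with hlt
      · simp only [List.mem_singleton] at hX; subst hX; exact hp
      · have hlt1 : ¬ (sh e).step < t₁ := fun h' => hlt (lt_of_lt_of_le h' h)
        show p ∈ parts sh t₁ (Gen.merge A B e)
        simp only [parts, if_neg hlt1]
        rcases List.mem_append.1 hX with hX | hX
        · exact List.mem_append.2 (Or.inl (parts_parts_of_le h hX hp))
        · exact List.mem_append.2 (Or.inr (parts_parts_of_le h hX hp))

/-- **COARSENING** (`t₀ < t₁`): a `t₀`-piece is its own only `t₁`-piece. [folklore] -/
theorem parts_eq_self_of_lt {t₀ t₁ : ℕ} (h : t₀ < t₁) :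
    ∀ {G X : Gen ε}, X ∈ parts sh t₀ G → parts sh t₁ X = [X]
  | Gen.born b j, X, hX => by
      simp only [parts, List.mem_singleton] at hX; subst hX; simp [parts]
  | Gen.renew W e hh, X, hX => parts_eq_self_of_lt h (G := W) hX
  | Gen.merge A B e, X, hX => by
      simp only [parts] at hX
      split_ifs at hX with hlt
      · simp only [List.mem_singleton] at hX; subst hX; simp [parts, hlt.trans h]
      · rcases List.mem_append.1 hX with hX | hX
        · exact parts_eq_self_of_lt h hX
        · exact parts_eq_self_of_lt h hX

/-- **PIECES OF PIECES ARE PIECES.** [folklore] -/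
theorem parts_trans {t₀ t₁ : ℕ} {G X p : Gen ε} (hX : X ∈ parts sh t₀ G) (hp : p ∈ parts sh t₁ X) :
    ∃ t₂, p ∈ parts sh t₂ G := by
  rcases le_or_gt t₁ t₀ with h | h
  · exact ⟨t₁, parts_parts_of_le h hX hp⟩
  · rw [parts_eq_self_of_lt h hX, List.mem_singleton] at hp
    subst hp
    exact ⟨t₀, hX⟩

/-- a birth is its own piece for any cut [folklore] -/
theorem self_mem_parts_born (b : ε) (j t₀ : ℕ) : Gen.born b j ∈ parts sh t₀ (Gen.born b j) := by
  simp [parts]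

/-- a merger is its own piece for any later cut [folklore] -/
theorem self_mem_parts_merge (A B : Gen ε) {e : ε} {t₀ : ℕ} (h : (sh e).step < t₀) :
    Gen.merge A B e ∈ parts sh t₀ (Gen.merge A B e) := by
  simp [parts, h]

/-- the union of an appended list of sets [folklore] -/
theorem lunion_append {β : Type*} [DecidableEq β] :
    ∀ l₁ l₂ : List (Finset β), lunion (l₁ ++ l₂) = lunion l₁ ∪ lunion l₂
  | [], l₂ => by simp [lunion]
  | S :: l₁, l₂ => by
      simp only [List.cons_append, lunion, lunion_append l₁ l₂, union_assoc]

/-- a member's set lies in the list union [folklore] -/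
theorem subset_lunion_of_mem {α β : Type*} [DecidableEq β] {l : List α} {S : α → Finset β} {a : α} (ha : a ∈ l) :
    S a ⊆ lunion (l.map S) := fun _ hu => mem_lunion.2 ⟨S a, List.mem_map.2 ⟨a, ha, rfl⟩, hu⟩

end Pieces

/-! ## §2 Touch-connected families of linked sets -/

section Families

/-- **TOUCH-CONNECTED LIST**: any two members are joined by a chain OF MEMBERS with consecutive `touch`. [folklore] -/
def TConn {α : Type*} (touch : α → α → Prop) (l : List α) : Prop :=
  ∀ p ∈ l, ∀ q ∈ l, Relation.ReflTransGen (fun a b => a ∈ l ∧ b ∈ l ∧ touch a b) p q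

/-- monotonicity of touch-connectedness in the touch relation (compared on members) [folklore] -/
theorem TConn.mono {α : Type*} {touch touch' : α → α → Prop} {l : List α}
    (h : ∀ a ∈ l, ∀ b ∈ l, touch a b → touch' a b) (hc : TConn touch l) : TConn touch' l :=
  fun p hp q hq =>
    Relation.ReflTransGen.mono (fun _ _ hab => ⟨hab.1, hab.2.1, h _ hab.1 _ hab.2.1 hab.2.2⟩) _ _ (hc p hp q hq)

/-- a one-member list is touch-connected [folklore] -/
theorem tconn_singleton {α : Type*} (touch : α → α → Prop) (a : α) : TConn touch [a] := by
  intro p hp q hq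
  rw [List.mem_singleton] at hp hq
  subst hp; subst hq
  exact Relation.ReflTransGen.refl

/-- **A TOUCH-CONNECTED FAMILY OF `ρ`-LINKED SETS, BRIDGED WITHIN `ρ` AT EVERY TOUCHING PAIR, HAS A `ρ`-LINKED UNION.**
[folklore] -/
theorem linked_lunion_of_tconn {α : Type*} {m ρ : ℕ} {l : List α} {S : α → Finset (Fin d → ℕ)}
    (hS : ∀ a ∈ l, Linked m ρ (S a))
    (hconn : TConn (fun a b => ∃ x ∈ S a, ∃ y ∈ S b, cdist m x y ≤ ρ) l) :
    Linked m ρ (lunion (l.map S)) := by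
  have lift : ∀ {a : α}, a ∈ l → ∀ {u v : Fin d → ℕ},
      Relation.ReflTransGen (fun x y => x ∈ S a ∧ y ∈ S a ∧ cdist m x y ≤ ρ) u v →
      Relation.ReflTransGen (fun x y => x ∈ lunion (l.map S) ∧ y ∈ lunion (l.map S) ∧ cdist m x y ≤ ρ) u v :=
    fun ha _ _ h => Relation.ReflTransGen.mono
      (fun _ _ hxy => ⟨subset_lunion_of_mem ha hxy.1, subset_lunion_of_mem ha hxy.2.1, hxy.2.2⟩) _ _ h
  have key : ∀ {a b : α},
      Relation.ReflTransGen (fun a b => a ∈ l ∧ b ∈ l ∧ ∃ x ∈ S a, ∃ y ∈ S b, cdist m x y ≤ ρ) a b → a ∈ l →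
        ∀ u ∈ S a, ∀ v ∈ S b,
          Relation.ReflTransGen (fun x y => x ∈ lunion (l.map S) ∧ y ∈ lunion (l.map S) ∧ cdist m x y ≤ ρ) u v := by
    intro a b hab ha
    induction hab with
    | refl => intro u hu v hv; exact lift ha (hS a ha u hu v hv)
    | tail _ hbc ih =>
        intro u hu v hv
        obtain ⟨hb', hc, x, hx, y, hy, hxy⟩ := hbc
        have h1 := ih u hu x hx
        have h2 : Relation.ReflTransGen
            (fun x y => x ∈ lunion (l.map S) ∧ y ∈ lunion (l.map S) ∧ cdist m x y ≤ ρ) x y :=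
          Relation.ReflTransGen.single ⟨subset_lunion_of_mem hb' hx, subset_lunion_of_mem hc hy, hxy⟩
        have h3 := lift hc (hS _ hc y hy v hv)
        exact h1.trans (h2.trans h3)
  intro u hu v hv
  obtain ⟨Sa, hSa, hu⟩ := mem_lunion.1 hu
  obtain ⟨a, ha, rfl⟩ := List.mem_map.1 hSa
  obtain ⟨Sb, hSb, hv⟩ := mem_lunion.1 hv
  obtain ⟨b, hb, rfl⟩ := List.mem_map.1 hSb
  exact key (hconn a ha b hb) ha u hu v hv

end Families

/-! ## §3 The slim levelled reading and the ancestor decomposition over it -/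

section Steps

variable {ε : Type*} (sh : ε → PEv)

/-- **THE SLIM LEVELLED TOLERANT READING**: `HistoryZones.ZoneReadingD` WITHOUT the birth-diameter and binary-contact
(`overlap`) fields — zones in range of their level torus, union at a merger's step, the tolerant levelled step,
renewals add nothing.  These are the only fields the ancestor decomposition and the cardinality law use. [folklore] -/
structure ZoneStepsD (n L K : ℕ) (lv : ℕ → ℕ) (c : ℕ) (G : Gen ε) (zone : ℕ → Gen ε → Finset (Fin d → ℕ)) :
    Prop where
  /-- zones of step `t` live on `(ℤ∕nL^{K − lv t})^d` -/
  inRange : ∀ (t : ℕ) (X : Gen ε), Sub X G → InRange (n * L ^ (K - lv t)) (zone t X)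
  /-- at the merger's shape-step the merged zone lies inside the union of the partners' zones -/
  union : ∀ (X Y : Gen ε) (e : ε), Sub (Gen.merge X Y e) G →
    zone (sh e).step (Gen.merge X Y e) ⊆ zone (sh e).step X ∪ zone (sh e).step Y
  /-- TOLERANT LEVELLED STEP -/
  step : ∀ (X : Gen ε) (t : ℕ), Sub X G → ftime (PEv.step ∘ sh) X ≤ t → t + 1 ≤ K →
    zone (t + 1) X ⊆ thickT (n * L ^ (K - lv (t + 1))) c (blocks (L ^ (lv (t + 1) - lv t)) (zone t X))
  /-- a renewal adds nothing to the zone -/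
  renew : ∀ (X : Gen ε) (e : ε) (h t : ℕ), Sub (Gen.renew X e h) G → zone t (Gen.renew X e h) ⊆ zone t X

variable {sh} {n L K c : ℕ} {lv : ℕ → ℕ} {Cb : ℝ} {G : Gen ε} {zone : ℕ → Gen ε → Finset (Fin d → ℕ)}

/-- the full levelled reading is a slim one [folklore] -/
theorem ZoneStepsD.of_readingD (hR : ZoneReadingD sh n L K lv Cb c G zone) : ZoneStepsD sh n L K lv c G zone where
  inRange := hR.inRange
  union := hR.union
  step := hR.step
  renew := hR.renew

/-- a sub-structure's zone `k` steps after a step it is formed by lies in the levelled evolution of its zone then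
[folklore] -/
theorem zone_subset_evolveS (hR : ZoneStepsD sh n L K lv c G zone) {X : Gen ε} (hX : Sub X G) {u : ℕ}
    (hft : ftime (PEv.step ∘ sh) X ≤ u) : ∀ k : ℕ, u + k ≤ K → zone (u + k) X ⊆ evolveD n L K lv c u k (zone u X)
  | 0, _ => subset_rfl
  | k + 1, hk => by
      have ih := zone_subset_evolveS hR hX hft k (Nat.le_of_succ_le hk)
      have hstep := hR.step X (u + k) hX (hft.trans (Nat.le_add_right u k)) hk
      show zone (u + k + 1) X ⊆ thickT (sideD n L K lv (u + k + 1)) c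
        (blocks (L ^ (lv (u + k + 1) - lv (u + k))) (evolveD n L K lv c u k (zone u X)))
      exact hstep.trans (thickT_mono _ _ (image_subset_image ih))

variable [DecidableEq ε]

/-- **THE ANCESTOR DECOMPOSITION OVER THE SLIM READING** (chronological reading, `X` formed by `t ≤ K`, cut
`t₀ ≤ t + 1`): `zone t X ⊆ ⋃_{p ∈ parts t₀ X} evolveD (ustart p) (t − ustart p) (zone (ustart p) p)`. [folklore] -/
theorem zone_subset_partsS (hR : ZoneStepsD sh n L K lv c G zone) (hchr : Chrono (PEv.step ∘ sh) G) (t₀ : ℕ) :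
    ∀ {X : Gen ε}, Sub X G → ∀ {t : ℕ}, t₀ ≤ t + 1 → ftime (PEv.step ∘ sh) X ≤ t → t ≤ K →
      zone t X ⊆ lunion ((parts sh t₀ X).map fun p =>
        evolveD n L K lv c (ustart sh t₀ p) (t - ustart sh t₀ p) (zone (ustart sh t₀ p) p))
  | Gen.born b j, hX, t, ht₀, hft, htK => by
      simp only [parts, List.map_cons, List.map_nil, lunion, union_empty]
      have hfu : ftime (PEv.step ∘ sh) (Gen.born b j) ≤ ustart sh t₀ (Gen.born b j) := le_max_right _ _
      have hut : ustart sh t₀ (Gen.born b j) ≤ t := max_le (by omega) hft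
      have h := zone_subset_evolveS hR hX hfu (t - ustart sh t₀ (Gen.born b j)) (by omega)
      rwa [Nat.add_sub_cancel' hut] at h
  | Gen.renew Y e h, hX, t, ht₀, hft, htK => by
      have hY : Sub Y G := Sub.trans (Sub.renew e h (Sub.refl Y)) hX
      exact (hR.renew Y e h t hX).trans (zone_subset_partsS hR hchr t₀ hY ht₀ hft htK)
  | Gen.merge Y Z e, hX, t, ht₀, hft, htK => by
      by_cases hlt : (sh e).step < t₀
      · simp only [parts, if_pos hlt, List.map_cons, List.map_nil, lunion, union_empty]
        have hfu : ftime (PEv.step ∘ sh) (Gen.merge Y Z e) ≤ ustart sh t₀ (Gen.merge Y Z e) := le_max_right _ _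
        have hut : ustart sh t₀ (Gen.merge Y Z e) ≤ t := max_le (by omega) hft
        have h := zone_subset_evolveS hR hX hfu (t - ustart sh t₀ (Gen.merge Y Z e)) (by omega)
        rwa [Nat.add_sub_cancel' hut] at h
      · simp only [parts, if_neg hlt, List.map_append]
        have hfte : ftime (PEv.step ∘ sh) (Gen.merge Y Z e) = (sh e).step := rfl
        rw [hfte] at hft
        have hchrX := chrono_of_sub (PEv.step ∘ sh) hX hchr
        obtain ⟨hfY, hfZ⟩ := ftime_le_of_chrono (PEv.step ∘ sh) hchrX
        have hY : Sub Y G := Sub.trans (Sub.left Z e (Sub.refl Y)) hX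
        have hZ : Sub Z G := Sub.trans (Sub.right Y e (Sub.refl Z)) hX
        have hsK : (sh e).step ≤ K := hft.trans htK
        have ht₀s : t₀ ≤ (sh e).step + 1 := by omega
        have hdY := zone_subset_partsS hR hchr t₀ hY ht₀s hfY hsK
        have hdZ := zone_subset_partsS hR hchr t₀ hZ ht₀s hfZ hsK
        have h0 := zone_subset_evolveS hR hX (u := (sh e).step) le_rfl (t - (sh e).step) (by omega)
        rw [Nat.add_sub_cancel' hft] at h0
        have h1 := h0.trans (evolveD_mono (sh e).step (t - (sh e).step) (hR.union Y Z e hX))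
        rw [evolveD_union] at h1
        have push : ∀ {W : Gen ε}, Sub W G → ftime (PEv.step ∘ sh) W ≤ (sh e).step → ∀ l : List (Gen ε),
            (∀ p ∈ l, p ∈ parts sh t₀ W) →
            evolveD n L K lv c (sh e).step (t - (sh e).step) (lunion (l.map fun p =>
              evolveD n L K lv c (ustart sh t₀ p) ((sh e).step - ustart sh t₀ p) (zone (ustart sh t₀ p) p))) ⊆
            lunion (l.map fun p =>
              evolveD n L K lv c (ustart sh t₀ p) (t - ustart sh t₀ p) (zone (ustart sh t₀ p) p)) := by
          intro W hW hfW l hl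
          induction l with
          | nil => simp [lunion, evolveD_empty]
          | cons p l ihl =>
              simp only [List.map_cons, lunion]
              rw [evolveD_union]
              refine union_subset_union (le_of_eq ?_) (ihl fun q hq => hl q (List.mem_cons_of_mem _ hq))
              have hp := hl p List.mem_cons_self
              have hup : ustart sh t₀ p ≤ (sh e).step :=
                max_le (by omega) ((ftime_le_of_sub _ (sub_of_mem_parts t₀ hp)
                  (chrono_of_sub (PEv.step ∘ sh) hW hchr)).trans hfW)
              exact evolve_pieceD hup hft
        intro z hz
        rw [mem_lunion]
        rcases mem_union.1 (h1 hz) with h | h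
        · have h' := push hY hfY _ (fun p hp => hp) (evolveD_mono _ _ hdY h)
          obtain ⟨S, hS, hzS⟩ := mem_lunion.1 h'
          exact ⟨S, List.mem_append.2 (Or.inl hS), hzS⟩
        · have h' := push hZ hfZ _ (fun p hp => hp) (evolveD_mono _ _ hdZ h)
          obtain ⟨S, hS, hzS⟩ := mem_lunion.1 h'
          exact ⟨S, List.mem_append.2 (Or.inr hS), hzS⟩

end Steps

/-! ## §4 Sanity (decided) -/

namespace Sanity

/-- pieces of pieces: for the merger (step `3`) of the births at steps `0` and `2` (shapes read by `Prod.fst`), the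
cut-`1` pieces are the two births; re-cutting the old birth at `1` returns it alone, at `4` too (decided) -/
example :
    (parts (Prod.fst : PEv × ℕ → PEv) 1
        (Gen.merge (Gen.born (((0, 0, 5) : PEv), 0) 0) (Gen.born (((2, 0, 1) : PEv), 1) 2)
          (((3, 2, 0) : PEv), 2))) =
      [Gen.born (((0, 0, 5) : PEv), 0) 0, Gen.born (((2, 0, 1) : PEv), 1) 2] ∧
    parts (Prod.fst : PEv × ℕ → PEv) 4 (Gen.born (((0, 0, 5) : PEv), 0) 0) = [Gen.born (((0, 0, 5) : PEv), 0) 0] := by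
  decide

/-- a three-member list touching in a path `0 – 1 – 2` (touch = «differ by one») is touch-connected; its
reflexive-transitive chain from `0` to `2` has the member `1` in between -/
example : Relation.ReflTransGen (fun a b : ℕ => a ∈ [0, 1, 2] ∧ b ∈ [0, 1, 2] ∧ (a + 1 = b ∨ b + 1 = a)) 0 2 :=
  (Relation.ReflTransGen.single ⟨by simp, by simp, Or.inl rfl⟩).trans
    (Relation.ReflTransGen.single ⟨by simp, by simp, Or.inl rfl⟩)

end Sanity

end

end Summit.QuantumFields.BalabanUV.T4Continuum.HistoryZoneMassPieces
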